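import Literature.NumberTheory.GaloisRepresentations.MultiKummerField
import Literature.NumberTheory.GaloisRepresentations.EisensteinCubicIndex
import Literature.NumberTheory.GaloisRepresentations.SplitPrimeResidueNorm
import Mathlib.LinearAlgebra.FreeModule.IdealQuotient
import HarnessLib

/-!
# Multi-Kummer fields `k(∛p : p ∈ S)`: the full Galois group and the primes above `S` and `q`

Topic `NumberTheory/GaloisRepresentations`; namespace
`Literature.NumberTheory.GaloisRepresentations.MultiKummer` (sequel to `MultiKummerField.lean`).
Everything PROVED; no named facts.

For a multi-Kummer field `L = k(μ_p : p ∈ S)` over `k = ℚ(ρ)` (`IsMultiKummer ρ S μ`, all `p ∈ S`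
primes `≡ 2 (mod 3)`, hence inert in `k`, tree `EisensteinCubic.isPrime_span_natCast`):

* `root_not_mem_adjoin_erase`: `μ_p ∉ k(μ_{p'} : p' ≠ p)` — by the VALUATION at a prime above `p`,
  at which the smaller field is unramified (`MultiKummerField.valuation_algebraMap_eq`) while
  `v(p) = 3 v(μ_p)`; hence (`exists_emm`, Galois correspondence) Cassels' automorphisms
  `M_p : μ_p ↦ ρ μ_p, μ_{p'} ↦ μ_{p'}` ([VI] p. 67: "the automorphisms … which take `m^{1/3}` into
  `ρm^{1/3}`") exist: `emm`, `expnt_emm_self`, `expnt_emm_ne`; and `Gal(L/k) ≅ (ℤ/3)^S`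
  (`exists_expnt_eq`: every exponent vector occurs);
* primes `w` above an inert rational prime `q ≡ 2 (mod 3)`, `q ∉ S`: the identity is a Frobenius
  (`isArithFrobAt_one_of_inert`: `μ_p^{q²} = μ_p · p^{(q²−1)/3} ≡ μ_p`), `Gal(L/k)` acts freely on the
  primes above `q` (`smul_eq_self_iff_of_inert`), and every residue is represented by an element of
  `𝓞 k` (`exists_sub_algebraMap_mem_of_inert`) — Cassels' "`q` remains prime in `ℚ(ρ)` but splits
  in `ℚ(ρ, m^{1/3})` into three prime ideal factors of absolute degree `2`" ([VI] Lemma 2);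
* primes `w` above `p ∈ S`: the inertia AND decomposition groups equal the cyclic group
  `⟨M_p⟩ = {σ : expnt σ p' = 0 ∀ p' ≠ p}` (`inertia_eq_kp`, `stabilizer_eq_kp`), `v_w(μ_p) = 1`
  normalised (`valuation_root_of_mem`), and again residues come from `𝓞 k`
  (`exists_sub_algebraMap_mem_of_mem`).

## References

* J. W. S. Cassels, *Arithmetic on curves of genus 1. VI*, J. reine angew. Math. 214/215 (1964),
  65–70, p. 67 and Lemma 2 (p. 68). [Cassels1964ArithmeticVI]
* D. A. Marcus, *Number Fields*, 2nd ed. (2018), Ch. 4 (decomposition and inertia groups, Thm. 28,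
  Thm. 33). [Marcus2018]
* S. Lang, *Fundamentals of Diophantine Geometry* (1983), Ch. 6 Prop. 1.3. [Lang1983]
-/

noncomputable section

open scoped NumberField Pointwise

open NumberField IsDedekindDomain Literature.NumberTheory.EllipticCurves WithZero
open Literature.NumberTheory.Automorphic

universe u

namespace Literature.NumberTheory.GaloisRepresentations

namespace MultiKummer

variable {k L : Type u} [Field k] [Field L] [Algebra k L]
variable {ρ : k} {S : Finset ℕ} {μ : ℕ → L}

/-! ## Generalities on primes of `𝓞 L` and the Galois action -/

section General

variable [NumberField k] [NumberField L]

omit [NumberField L] in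
/-- Two distinct rational primes are not both in a prime ideal. [folklore] -/
theorem natCast_not_mem_of_natCast_mem (w : HeightOneSpectrum (𝓞 L)) {p q : ℕ} (hp : p.Prime)
    (hq : q.Prime) (hpq : p ≠ q) (hqw : (q : 𝓞 L) ∈ w.asIdeal) : (p : 𝓞 L) ∉ w.asIdeal := by
  intro hpw
  have hcop : IsCoprime (p : ℤ) (q : ℤ) := by
    rw [Int.isCoprime_iff_gcd_eq_one, Int.gcd_natCast_natCast]
    exact (Nat.coprime_primes hp hq).mpr hpq
  obtain ⟨a, b, hab⟩ := hcop
  have h1 : (1 : 𝓞 L) ∈ w.asIdeal := by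
    have := congrArg (Int.castRingHom (𝓞 L)) hab
    simp only [map_add, map_mul, map_one, eq_intCast, Int.cast_natCast] at this
    rw [← this]
    exact w.asIdeal.add_mem (w.asIdeal.mul_mem_left _ hpw) (w.asIdeal.mul_mem_left _ hqw)
  exact w.isPrime.ne_top ((Ideal.eq_top_iff_one _).mpr h1)

omit [NumberField L] in
/-- The prime of `𝓞 k` below a prime `w ∋ q` of `𝓞 L` is `(q)`, when `q ≡ 2 (mod 3)` is inert in
`k = ℚ(ρ)`. [cite: IrelandRosen1982, Ch. 9 §1 Prop. 9.1.4] -/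
theorem under_eq_span_of_inert [IsCyclotomicExtension {3} ℚ k] (w : HeightOneSpectrum (𝓞 L))
    {q : ℕ} (hq : q.Prime) (hq3 : q % 3 = 2) (hqw : (q : 𝓞 L) ∈ w.asIdeal) :
    (w.under (𝓞 k)).asIdeal = Ideal.span {(q : 𝓞 k)} := by
  have hprime := EisensteinCubic.isPrime_span_natCast (K := k) hq hq3
  have hne : Ideal.span {(q : 𝓞 k)} ≠ ⊥ := by
    rw [Ne, Ideal.span_singleton_eq_bot]; exact_mod_cast hq.ne_zero
  haveI hmax : (Ideal.span {(q : 𝓞 k)}).IsMaximal := hprime.isMaximal hne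
  symm
  refine hmax.eq_of_le (w.under (𝓞 k)).isPrime.ne_top ?_
  rw [Ideal.span_le, Set.singleton_subset_iff, SetLike.mem_coe, HeightOneSpectrum.under_asIdeal,
    Ideal.under_def, Ideal.mem_comap, map_natCast]
  exact hqw

omit [NumberField L] in
/-- `v_{(q)}(q) = 1` (normalised; Mathlib: `exp (-1)`) at the inert prime `(q)` of `k`. [folklore] -/
theorem valuation_under_natCast_of_inert [IsCyclotomicExtension {3} ℚ k] (w : HeightOneSpectrum (𝓞 L))
    {q : ℕ} (hq : q.Prime) (hq3 : q % 3 = 2) (hqw : (q : 𝓞 L) ∈ w.asIdeal) :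
    (w.under (𝓞 k)).valuation k (q : k) = exp (-1 : ℤ) := by
  rw [show (q : k) = algebraMap (𝓞 k) k (q : 𝓞 k) by rw [map_natCast],
    HeightOneSpectrum.valuation_of_algebraMap]
  exact HeightOneSpectrum.intValuation_singleton _ (by exact_mod_cast hq.ne_zero)
    (under_eq_span_of_inert w hq hq3 hqw)

omit [NumberField L] in
/-- The residue ring of the prime below `w ∋ q` has `q²` elements (`q` inert in `ℚ(ρ)`).
[cite: IrelandRosen1982, Ch. 9 §1 Prop. 9.1.4] -/
theorem card_quotient_under_of_inert [IsCyclotomicExtension {3} ℚ k] (w : HeightOneSpectrum (𝓞 L))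
    {q : ℕ} (hq : q.Prime) (hq3 : q % 3 = 2) (hqw : (q : 𝓞 L) ∈ w.asIdeal) :
    Nat.card (𝓞 k ⧸ (w.under (𝓞 k)).asIdeal) = q ^ 2 := by
  rw [under_eq_span_of_inert w hq hq3 hqw, ← Submodule.cardQuot_apply, ← Ideal.absNorm_apply,
    EisensteinCubic.absNorm_span_natCast']

omit [NumberField L] in
/-- Fermat: `a^{(q² − 1)/3} ≡ 1 (mod q)` for `a` prime to `q` and `q ≡ 2 (mod 3)` (as `q − 1`
divides `(q² − 1)/3 = (q − 1)(q + 1)/3`). [folklore] -/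
theorem pow_sq_sub_one_div_three_sub_one_mem {q : ℕ} (hq : q.Prime) (hq3 : q % 3 = 2) {a : ℕ}
    (ha : ¬ q ∣ a) (w : HeightOneSpectrum (𝓞 L)) (hqw : (q : 𝓞 L) ∈ w.asIdeal) :
    (a : 𝓞 L) ^ ((q ^ 2 - 1) / 3) - 1 ∈ w.asIdeal := by
  -- `(q² - 1)/3 = (q - 1) * ((q + 1)/3)`
  obtain ⟨j, hj⟩ : 3 ∣ q + 1 := by omega
  have hq1 : 1 ≤ q := hq.one_lt.le
  have hdiv : (q ^ 2 - 1) / 3 = (q - 1) * j := by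
    have hsq : q ^ 2 - 1 = (q - 1) * (q + 1) := by
      zify [hq1, Nat.one_le_pow 2 q hq1]; ring
    rw [hsq, hj, show (q - 1) * (3 * j) = 3 * ((q - 1) * j) by ring,
      Nat.mul_div_cancel_left _ (by norm_num)]
  haveI : Fact q.Prime := ⟨hq⟩
  have hF : (a : ZMod q) ^ (q - 1) = 1 := ZMod.pow_card_sub_one_eq_one (by
    intro h0; exact ha ((ZMod.natCast_eq_zero_iff a q).mp h0))
  have hdvd : (q : ℤ) ∣ (a : ℤ) ^ ((q ^ 2 - 1) / 3) - 1 := by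
    rw [← ZMod.intCast_zmod_eq_zero_iff_dvd]; push_cast
    rw [hdiv, pow_mul, hF, one_pow, sub_self]
  obtain ⟨c, hc⟩ := hdvd
  have h := congrArg (Int.castRingHom (𝓞 L)) hc
  simp only [map_sub, map_pow, map_mul, map_one, eq_intCast, Int.cast_natCast] at h
  rw [h]
  exact w.asIdeal.mul_mem_right _ hqw

omit [NumberField k] in
/-- **If the identity is a Frobenius at `w`, then the decomposition group of `w` is its inertia
group** (the residue field of `w` is that of the prime below, so an automorphism fixing `w` acts
trivially on it) — extracted from the tree's `SplitNorm.free_of_inertia_eq_bot_of_isArithFrobAt_one`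
(Marcus Ch. 4 Thm. 28). [cite: Marcus2018, Ch. 4 Thm. 28] -/
theorem exists_sub_algebraMap_mem_of_isArithFrobAt_one {w : HeightOneSpectrum (𝓞 L)}
    (hfrob : IsArithFrobAt (𝓞 k) (1 : L ≃ₐ[k] L) w.asIdeal) (x : 𝓞 L) :
    ∃ c : 𝓞 k, x - algebraMap (𝓞 k) (𝓞 L) c ∈ w.asIdeal := by
  classical
  set Q₀ := w.asIdeal
  set P := Q₀.under (𝓞 k)
  haveI : Q₀.IsMaximal := w.isMaximal
  haveI hPmax : P.IsMaximal := Ideal.IsMaximal.under (𝓞 k) Q₀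
  letI := Ideal.Quotient.field Q₀
  letI := Ideal.Quotient.field P
  haveI : Finite (𝓞 k ⧸ P) := hfrob.finite_quotient
  haveI : Finite (𝓞 L ⧸ Q₀) := Ideal.finiteQuotientOfFreeOfNeBot Q₀ w.ne_bot
  letI := Fintype.ofFinite (𝓞 k ⧸ P)
  letI := Fintype.ofFinite (𝓞 L ⧸ Q₀)
  set N := Nat.card (𝓞 k ⧸ P) with hN
  have hNcard : N = Fintype.card (𝓞 k ⧸ P) := Nat.card_eq_fintype_card
  have hN1 : 1 < N := by rw [hNcard]; exact Fintype.one_lt_card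
  have hroot : ∀ y : 𝓞 L ⧸ Q₀, y ^ N = y := by
    intro y
    obtain ⟨x, rfl⟩ := Ideal.Quotient.mk_surjective y
    have h := hfrob x
    simp only [MulSemiringAction.toAlgHom_apply, one_smul] at h
    rw [← map_pow, eq_comm, Ideal.Quotient.eq]
    exact h
  have hcardle : Fintype.card (𝓞 L ⧸ Q₀) ≤ N := by
    set Pl : Polynomial (𝓞 L ⧸ Q₀) := Polynomial.X ^ N - Polynomial.X with hPl
    have hP0 : Pl ≠ 0 := FiniteField.X_pow_card_sub_X_ne_zero _ hN1
    have hdeg : Pl.natDegree = N := by rw [hPl]; exact FiniteField.X_pow_card_sub_X_natDegree_eq _ hN1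
    calc Fintype.card (𝓞 L ⧸ Q₀) = (Finset.univ : Finset (𝓞 L ⧸ Q₀)).card := rfl
      _ ≤ Pl.roots.toFinset.card := Finset.card_le_card fun y _ ↦ by
          rw [Multiset.mem_toFinset, Polynomial.mem_roots hP0, hPl, Polynomial.IsRoot.def,
            Polynomial.eval_sub, Polynomial.eval_pow, Polynomial.eval_X, hroot y, sub_self]
      _ ≤ Multiset.card Pl.roots := Multiset.toFinset_card_le _
      _ ≤ Pl.natDegree := Polynomial.card_roots' Pl
      _ = N := hdeg
  have hinj : Function.Injective (algebraMap (𝓞 k ⧸ P) (𝓞 L ⧸ Q₀)) := RingHom.injective _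
  have hbij : Function.Bijective (algebraMap (𝓞 k ⧸ P) (𝓞 L ⧸ Q₀)) := by
    rw [Fintype.bijective_iff_injective_and_card]
    refine ⟨hinj, le_antisymm (Fintype.card_le_of_injective _ hinj) ?_⟩
    rw [← hNcard]; exact hcardle
  obtain ⟨c₀, hc₀⟩ := hbij.2 (Ideal.Quotient.mk Q₀ x)
  obtain ⟨c, rfl⟩ := Ideal.Quotient.mk_surjective c₀
  exact ⟨c, by rw [← Ideal.Quotient.eq, ← hc₀]; rfl⟩

omit [NumberField k] in
/-- **Decomposition = inertia when the identity is a Frobenius.** [cite: Marcus2018, Ch. 4 Thm. 28] -/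
theorem mem_inertia_of_smul_eq_of_isArithFrobAt_one {w : HeightOneSpectrum (𝓞 L)}
    (hfrob : IsArithFrobAt (𝓞 k) (1 : L ≃ₐ[k] L) w.asIdeal) {σ : L ≃ₐ[k] L} (hσ : σ • w = w) :
    σ ∈ w.asIdeal.inertia (L ≃ₐ[k] L) := by
  have hσQ : σ • w.asIdeal = w.asIdeal := by
    have h := congrArg HeightOneSpectrum.asIdeal hσ
    rwa [HeightOneSpectrum.smul_asIdeal] at h
  intro x
  obtain ⟨c, hxc⟩ := exists_sub_algebraMap_mem_of_isArithFrobAt_one hfrob x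
  have h1 : σ • (x - algebraMap (𝓞 k) (𝓞 L) c) ∈ w.asIdeal := by
    rw [← hσQ]; exact Ideal.smul_mem_pointwise_smul_iff.mpr hxc
  rw [smul_sub, SplitNorm.algEquiv_smul_algebraMap] at h1
  have := w.asIdeal.sub_mem h1 hxc
  rwa [sub_sub_sub_cancel_right] at this

end General

/-! ## `μ_p ∉ k(μ_{p'} : p' ≠ p)` and the automorphisms `M_p` -/

section Surjective

variable [NumberField k] [NumberField L] [IsGalois k L] [IsCyclotomicExtension {3} ℚ k]
  (H : IsMultiKummer ρ S μ)
include H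

omit [IsGalois k L] [IsCyclotomicExtension {3} ℚ k] in
/-- The subfield generated by all the cube roots but `μ_p` is stable under `Gal(L/k)`.
[folklore] -/
theorem map_adjoin_erase_le (p : ℕ) (σ : L ≃ₐ[k] L) :
    (IntermediateField.adjoin k (μ '' ((S.erase p : Finset ℕ) : Set ℕ))).map (σ : L →ₐ[k] L) ≤
      IntermediateField.adjoin k (μ '' ((S.erase p : Finset ℕ) : Set ℕ)) := by
  rw [IntermediateField.adjoin_map, IntermediateField.adjoin_le_iff]
  rintro _ ⟨_, ⟨p', hp', rfl⟩, rfl⟩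
  have hp'S : p' ∈ S := Finset.mem_of_mem_erase hp'
  change σ (μ p') ∈ _
  rw [apply_root H σ hp'S, ← map_pow]
  exact mul_mem (IntermediateField.algebraMap_mem _ _)
    (IntermediateField.subset_adjoin _ _ ⟨p', hp', rfl⟩)

/-- **`μ_p ∉ k(μ_{p'} : p' ∈ S, p' ≠ p)`** — the heart of `[L : k] = 3^{#S}`: at a prime `w` above
`p` of the smaller multi-Kummer field `E` (unramified at `p ∉ S ∖ {p}`, `p ≠ 3`) we have
`v_w(p) = v_{(p)}(p) = 1`, which is not `3 v_w(μ_p)`. [cite: Lang1983, Ch. 6 Prop. 1.3] -/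
theorem root_not_mem_adjoin_erase {p : ℕ} (hp : p ∈ S) :
    μ p ∉ IntermediateField.adjoin k (μ '' ((S.erase p : Finset ℕ) : Set ℕ)) := by
  classical
  intro hmem
  set T : Finset ℕ := S.erase p with hT
  set E : IntermediateField k L := IntermediateField.adjoin k (μ '' (T : Set ℕ)) with hE
  haveI : FiniteDimensional k L := finiteDimensional
  haveI : FiniteDimensional k E := IntermediateField.finiteDimensional_left E
  haveI : NumberField E := NumberField.of_module_finite k E
  haveI : Normal k E := by
    rw [IntermediateField.normal_iff_forall_map_le']
    intro σ
    exact map_adjoin_erase_le H p σ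
  haveI : IsGalois k E := ⟨⟩
  -- `E` is multi-Kummer for `T`
  let μE : ℕ → E := fun p' => if h : p' ∈ T then ⟨μ p', IntermediateField.subset_adjoin _ _ ⟨p', h, rfl⟩⟩ else 0
  have hμE : ∀ p' ∈ T, (μE p' : L) = μ p' := fun p' h => by simp only [μE, dif_pos h]
  have HE : IsMultiKummer ρ T μE :=
    { rho_sq := H.rho_sq
      prime_of_mem := fun p' hp' => H.prime_of_mem p' (Finset.mem_of_mem_erase hp')
      pow_three := fun p' hp' => by
        apply Subtype.ext
        change ((μE p' : E) : L) ^ 3 = ((p' : E) : L)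
        rw [hμE p' hp', H.pow_three p' (Finset.mem_of_mem_erase hp')]
        rfl
      adjoin_eq_top := by
        apply IntermediateField.lift_injective
        rw [IntermediateField.lift_adjoin, IntermediateField.lift_top]
        congr 1
        ext x
        constructor
        · rintro ⟨_, ⟨p', hp', rfl⟩, rfl⟩; exact ⟨p', hp', (hμE p' hp').symm⟩
        · rintro ⟨p', hp', rfl⟩; exact ⟨μE p', ⟨p', hp', rfl⟩, hμE p' hp'⟩ }
  -- a prime of `𝓞 E` above `p`
  obtain ⟨hpP, hp3⟩ := H.prime_of_mem p hp
  haveI : (Ideal.span {(p : ℤ)}).IsMaximal :=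
    Ideal.IsPrime.isMaximal ((Ideal.span_singleton_prime (by exact_mod_cast hpP.ne_zero)).mpr
      (Nat.prime_iff_prime_int.mp hpP)) (by simpa using hpP.ne_zero)
  obtain ⟨⟨Q, hQ, hQo⟩⟩ := (Ideal.span {(p : ℤ)}).nonempty_primesOver (S := 𝓞 E)
  have hbot : Ideal.span {(p : ℤ)} ≠ ⊥ := by
    rw [Ne, Ideal.span_singleton_eq_bot]; exact_mod_cast hpP.ne_zero
  have hQne : Q ≠ ⊥ := Ideal.ne_bot_of_liesOver_of_ne_bot hbot Q
  let w : HeightOneSpectrum (𝓞 E) := ⟨Q, hQ, hQne⟩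
  have hpw : (p : 𝓞 E) ∈ w.asIdeal := by
    have : (algebraMap ℤ (𝓞 E)) (p : ℤ) ∈ Q := by
      rw [← Ideal.mem_comap, ← Ideal.under_def, ← hQo.over]
      exact Ideal.mem_span_singleton_self _
    simpa using this
  -- `w ∤ 3 ∏ T`
  have h3 : (3 : 𝓞 E) ∉ w.asIdeal := by
    have := natCast_not_mem_of_natCast_mem w Nat.prime_three hpP (by omega) hpw
    exact_mod_cast this
  have hS : ∀ p' ∈ T, (p' : 𝓞 E) ∉ w.asIdeal := fun p' hp' =>
    natCast_not_mem_of_natCast_mem w (H.prime_of_mem p' (Finset.mem_of_mem_erase hp')).1 hpP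
      (Finset.ne_of_mem_erase hp') hpw
  -- valuations: `v_w(p) = v_{(p)}(p) = exp(-1)` but `p = μ_p³`
  have hval := valuation_algebraMap_eq HE w h3 hS (p : k)
  rw [valuation_under_natCast_of_inert w hpP hp3 hpw] at hval
  have hcube : algebraMap k E (p : k) = (⟨μ p, hmem⟩ : E) ^ 3 := by
    apply Subtype.ext
    change ((algebraMap k E (p : k) : E) : L) = μ p ^ 3
    rw [map_natCast, H.pow_three p hp]
    rfl
  rw [hcube, map_pow] at hval
  have hlog := congrArg log hval
  simp only [log_pow, log_exp, nsmul_eq_mul] at hlog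
  push_cast at hlog
  omega

/-- **Existence of `M_p`** ([VI] p. 67): for `p ∈ S` there is `σ ∈ Gal(L/k)` moving `μ_p` and
fixing all other `μ_{p'}` — a non-trivial element of the fixing subgroup of
`E = k(μ_{p'} : p' ≠ p) ≠ L` (Galois correspondence). [cite: Cassels1964ArithmeticVI, p. 67] -/
theorem exists_expnt_ne_zero {p : ℕ} (hp : p ∈ S) :
    ∃ σ : L ≃ₐ[k] L, expnt H σ p ≠ 0 ∧ ∀ p' ∈ S, p' ≠ p → expnt H σ p' = 0 := by
  classical
  haveI : FiniteDimensional k L := finiteDimensional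
  set E : IntermediateField k L := IntermediateField.adjoin k (μ '' ((S.erase p : Finset ℕ) : Set ℕ))
  have hEtop : E ≠ ⊤ := fun h => root_not_mem_adjoin_erase H hp (by
    change μ p ∈ E
    rw [h]; trivial)
  have hfix : E.fixingSubgroup ≠ ⊥ := by
    intro h
    apply hEtop
    rw [← IsGalois.fixedField_fixingSubgroup E, h, IntermediateField.fixedField_bot]
  obtain ⟨⟨σ, hσE⟩, hσ1⟩ := (Subgroup.ne_bot_iff_exists_ne_one).mp hfix
  have hσ' : ∀ p' ∈ S, p' ≠ p → expnt H σ p' = 0 := by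
    intro p' hp' hne
    rw [expnt_eq_iff H σ hp', ZMod.val_zero, pow_zero, one_mul]
    exact (IntermediateField.mem_fixingSubgroup_iff _ _).mp hσE _
      (IntermediateField.subset_adjoin _ _ ⟨p', Finset.mem_erase.mpr ⟨hne, hp'⟩, rfl⟩)
  refine ⟨σ, fun h0 => hσ1 (Subtype.ext ?_), hσ'⟩
  change (σ : L ≃ₐ[k] L) = 1
  exact eq_one_of_forall_expnt_eq_zero H σ fun p' hp' => by
    by_cases hne : p' = p
    · subst hne; exact h0
    · exact hσ' p' hp' hne

/-- There is an automorphism with exponent `1` at `p` and `0` elsewhere. [folklore] -/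
theorem exists_expnt_eq_single {p : ℕ} (hp : p ∈ S) :
    ∃ σ : L ≃ₐ[k] L, expnt H σ p = 1 ∧ ∀ p' ∈ S, p' ≠ p → expnt H σ p' = 0 := by
  obtain ⟨σ, hσ, hσ'⟩ := exists_expnt_ne_zero H hp
  have key : expnt H σ p = 1 ∨ expnt H σ p = 2 := by
    generalize expnt H σ p = c at hσ ⊢
    fin_cases c
    · exact absurd rfl hσ
    · exact Or.inl rfl
    · exact Or.inr rfl
  rcases key with h | h
  · exact ⟨σ, h, hσ'⟩
  · refine ⟨σ * σ, ?_, fun p' hp' hne => ?_⟩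
    · rw [expnt_mul H _ _ hp, h]; rfl
    · rw [expnt_mul H _ _ hp', hσ' p' hp' hne, add_zero]

/-- **Cassels' `M_p`** ([VI] p. 67): the automorphism of `L/k` with `M_p μ_p = ρ μ_p` and
`M_p μ_{p'} = μ_{p'}` for `p' ≠ p`. [cite: Cassels1964ArithmeticVI, p. 67] -/
def emm {p : ℕ} (hp : p ∈ S) : L ≃ₐ[k] L := (exists_expnt_eq_single H hp).choose

/-- `expnt M_p p = 1`. [cite: Cassels1964ArithmeticVI, p. 67] -/
theorem expnt_emm_self {p : ℕ} (hp : p ∈ S) : expnt H (emm H hp) p = 1 :=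
  (exists_expnt_eq_single H hp).choose_spec.1

/-- `expnt M_p p' = 0` for `p' ≠ p`. [cite: Cassels1964ArithmeticVI, p. 67] -/
theorem expnt_emm_ne {p : ℕ} (hp : p ∈ S) {p' : ℕ} (hp' : p' ∈ S) (hne : p' ≠ p) :
    expnt H (emm H hp) p' = 0 :=
  (exists_expnt_eq_single H hp).choose_spec.2 p' hp' hne

/-- `M_p μ_p = ρ μ_p`. [cite: Cassels1964ArithmeticVI, p. 67] -/
theorem emm_apply_self {p : ℕ} (hp : p ∈ S) : emm H hp (μ p) = algebraMap k L ρ * μ p := by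
  rw [apply_root H _ hp, expnt_emm_self H hp, ZMod.val_one, pow_one]

/-- `M_p μ_{p'} = μ_{p'}` (`p' ≠ p`). [cite: Cassels1964ArithmeticVI, p. 67] -/
theorem emm_apply_ne {p : ℕ} (hp : p ∈ S) {p' : ℕ} (hp' : p' ∈ S) (hne : p' ≠ p) :
    emm H hp (μ p') = μ p' := by
  rw [apply_root H _ hp', expnt_emm_ne H hp hp' hne, ZMod.val_zero, pow_zero, one_mul]

omit [IsGalois k L] [IsCyclotomicExtension {3} ℚ k] in
/-- `expnt (σⁿ) p = n • expnt σ p`. [folklore] -/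
theorem expnt_pow (σ : L ≃ₐ[k] L) {p : ℕ} (hp : p ∈ S) (n : ℕ) :
    expnt H (σ ^ n) p = n * expnt H σ p := by
  induction n with
  | zero => rw [pow_zero, expnt_one H hp, Nat.cast_zero, zero_mul]
  | succ n ih => rw [pow_succ, expnt_mul H _ _ hp, ih]; push_cast; ring

/-- **`Gal(L/k) → (ℤ/3)^S` is onto**: every exponent vector is realised (`Gal(L/k) ≅ (ℤ/3)^S`,
`[L : k] = 3^{#S}`). [folklore] -/
theorem exists_expnt_eq (f : ℕ → ZMod 3) :
    ∃ σ : L ≃ₐ[k] L, ∀ p ∈ S, expnt H σ p = f p := by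
  classical
  suffices hT : ∀ T : Finset ℕ, T ⊆ S → ∃ σ : L ≃ₐ[k] L,
      (∀ p ∈ T, expnt H σ p = f p) ∧ (∀ p ∈ S, p ∉ T → expnt H σ p = 0) by
    obtain ⟨σ, h, -⟩ := hT S le_rfl
    exact ⟨σ, h⟩
  intro T
  induction T using Finset.induction_on with
  | empty => intro _; exact ⟨1, fun p hp => absurd hp (Finset.notMem_empty p), fun p hp _ => expnt_one H hp⟩
  | insert p T hpT ih =>
    intro hsub
    obtain ⟨σ, hσ, hσ'⟩ := ih ((Finset.subset_insert p T).trans hsub)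
    have hp : p ∈ S := hsub (Finset.mem_insert_self p T)
    refine ⟨emm H hp ^ (f p).val * σ, fun p' hp' => ?_, fun p' hp' hnot => ?_⟩
    · rcases Finset.mem_insert.mp hp' with rfl | hp'T
      · rw [expnt_mul H _ _ hp, expnt_pow H _ hp, expnt_emm_self H hp, mul_one, hσ' _ hp hpT,
          add_zero, ZMod.natCast_zmod_val]
      · have hne : p' ≠ p := fun h => hpT (h ▸ hp'T)
        rw [expnt_mul H _ _ (hsub hp'), expnt_pow H _ (hsub hp'), expnt_emm_ne H hp (hsub hp') hne,
          mul_zero, zero_add, hσ p' hp'T]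
    · have hne : p' ≠ p := fun h => hnot (h ▸ Finset.mem_insert_self p T)
      have hp'T : p' ∉ T := fun h => hnot (Finset.mem_insert_of_mem h)
      rw [expnt_mul H _ _ hp', expnt_pow H _ hp', expnt_emm_ne H hp hp' hne, mul_zero, zero_add,
        hσ' p' hp' hp'T]

end Surjective

/-! ## Primes above an inert `q ∉ S` -/

section Inert

variable [NumberField k] [NumberField L] [IsGalois k L] [IsCyclotomicExtension {3} ℚ k]
  (H : IsMultiKummer ρ S μ)
include H

omit [NumberField k] [NumberField L] [IsGalois k L] [IsCyclotomicExtension {3} ℚ k] in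
/-- For `w ∋ q` with `q ∉ S ∪ {3}` prime: `w ∤ 3 ∏ S`. [folklore] -/
theorem not_mem_of_inert (w : HeightOneSpectrum (𝓞 L)) {q : ℕ} (hq : q.Prime) (hq3 : q % 3 = 2)
    (hqS : q ∉ S) (hqw : (q : 𝓞 L) ∈ w.asIdeal) :
    (3 : 𝓞 L) ∉ w.asIdeal ∧ ∀ p ∈ S, (p : 𝓞 L) ∉ w.asIdeal := by
  refine ⟨?_, fun p hp => natCast_not_mem_of_natCast_mem w (H.prime_of_mem p hp).1 hq
    (fun h => hqS (h ▸ hp)) hqw⟩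
  have := natCast_not_mem_of_natCast_mem w Nat.prime_three hq (by omega) hqw
  exact_mod_cast this

omit H [IsCyclotomicExtension {3} ℚ k] in
/-- The instances needed for Frobenius elements in `Gal(L/k)` acting on `𝓞 L`. [folklore] -/
theorem isGaloisGroup : IsGaloisGroup (L ≃ₐ[k] L) (𝓞 k) (𝓞 L) := by
  haveI : FiniteDimensional k L := finiteDimensional
  exact IsGaloisGroup.of_isFractionRing (L ≃ₐ[k] L) (𝓞 k) (𝓞 L) k L

/-- **The identity is a Frobenius at every prime above an inert `q ∉ S`** ([VI] Lemma 2: `q`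
"splits in `ℚ(ρ, m^{1/3})` into prime ideal factors of absolute degree 2"): a Frobenius `φ` fixes
each `μ_p` since `μ_p^{q²} = μ_p p^{(q²−1)/3} ≡ μ_p`, hence `φ = 1`.
[cite: Cassels1964ArithmeticVI, Lemma 2] -/
theorem isArithFrobAt_one_of_inert (w : HeightOneSpectrum (𝓞 L)) {q : ℕ} (hq : q.Prime)
    (hq3 : q % 3 = 2) (hqS : q ∉ S) (hqw : (q : 𝓞 L) ∈ w.asIdeal) :
    IsArithFrobAt (𝓞 k) (1 : L ≃ₐ[k] L) w.asIdeal := by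
  haveI : FiniteDimensional k L := finiteDimensional
  haveI := isGaloisGroup (k := k) (L := L)
  haveI := w.isPrime
  haveI : Finite (𝓞 L ⧸ w.asIdeal) := Ideal.finiteQuotientOfFreeOfNeBot _ w.ne_bot
  obtain ⟨φ, hφ⟩ := IsArithFrobAt.exists_of_isInvariant (𝓞 k) (L ≃ₐ[k] L) w.asIdeal
  obtain ⟨h3, hS⟩ := not_mem_of_inert H w hq hq3 hqS hqw
  have hN := card_quotient_under_of_inert (k := k) w hq hq3 hqw
  have hφ1 : φ = 1 := by
    refine eq_one_of_forall_apply_root H φ fun p hp => ?_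
    have hpw := hS p hp
    have hfix : φ • intRoot H hp = intRoot H hp := by
      refine SplitNorm.smul_eq_self_of_isArithFrobAt hφ (d := 3) (by exact_mod_cast h3)
        (a := (p : 𝓞 k)) (by rwa [map_natCast]) (by rw [map_natCast]; exact intRoot_pow_three H hp)
        ?_ ?_
      · rw [HeightOneSpectrum.under_asIdeal] at hN
        rw [hN]
        exact ⟨(q - 1) * ((q + 1) / 3), by
          obtain ⟨j, hj⟩ : 3 ∣ q + 1 := by omega
          have hq1 : 1 ≤ q := hq.one_lt.le
          rw [hj, Nat.mul_div_cancel_left _ (by norm_num : 0 < 3)]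
          have hj' : ((q : ℤ) + 1) = 3 * (j : ℤ) := by exact_mod_cast hj
          zify [hq1, Nat.one_le_pow 2 q hq1]
          linear_combination ((q : ℤ) - 1) * hj'⟩
      · rw [HeightOneSpectrum.under_asIdeal] at hN
        rw [hN, map_natCast]
        exact pow_sq_sub_one_div_three_sub_one_mem hq hq3
          (fun h => hqS ((Nat.prime_dvd_prime_iff_eq hq (H.prime_of_mem p hp).1).mp h ▸ hp)) w hqw
    have := congrArg (fun x : 𝓞 L => (x : L)) hfix
    simpa only [coe_smul_intRoot, coe_intRoot] using this
  rw [hφ1] at hφ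
  exact hφ

/-- **`Gal(L/k)` acts freely on the primes above an inert `q ∉ S`** (decomposition groups are
trivial: `e = f = 1` over `k`). [cite: Cassels1964ArithmeticVI, Lemma 2] -/
theorem smul_eq_self_iff_of_inert (w : HeightOneSpectrum (𝓞 L)) {q : ℕ} (hq : q.Prime)
    (hq3 : q % 3 = 2) (hqS : q ∉ S) (hqw : (q : 𝓞 L) ∈ w.asIdeal) (σ : L ≃ₐ[k] L) :
    σ • w = w ↔ σ = 1 := by
  refine ⟨fun h => ?_, fun h => by rw [h, one_smul]⟩
  obtain ⟨h3, hS⟩ := not_mem_of_inert H w hq hq3 hqS hqw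
  exact SplitNorm.free_of_inertia_eq_bot_of_isArithFrobAt_one (inertia_eq_bot H w h3 hS)
    (isArithFrobAt_one_of_inert H w hq hq3 hqS hqw) σ h

/-- **Residues at a prime above an inert `q ∉ S` are represented by `𝓞 k`** (the residue field is
`𝓞 k/(q) = 𝔽_{q²}`). [cite: Cassels1964ArithmeticVI, Lemma 2] -/
theorem exists_sub_algebraMap_mem_of_inert (w : HeightOneSpectrum (𝓞 L)) {q : ℕ} (hq : q.Prime)
    (hq3 : q % 3 = 2) (hqS : q ∉ S) (hqw : (q : 𝓞 L) ∈ w.asIdeal) (x : 𝓞 L) :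
    ∃ c : 𝓞 k, x - algebraMap (𝓞 k) (𝓞 L) c ∈ w.asIdeal :=
  exists_sub_algebraMap_mem_of_isArithFrobAt_one (isArithFrobAt_one_of_inert H w hq hq3 hqS hqw) x

end Inert

/-! ## Primes above `p ∈ S` -/

section AboveS

variable [NumberField k] [NumberField L] [IsGalois k L] [IsCyclotomicExtension {3} ℚ k]
  (H : IsMultiKummer ρ S μ)

/-- The subgroup `K_p = {σ : expnt σ p' = 0 for all p' ∈ S, p' ≠ p}` (it is `⟨M_p⟩`). [folklore] -/
def kp (H : IsMultiKummer ρ S μ) (p : ℕ) : Subgroup (L ≃ₐ[k] L) where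
  carrier := {σ | ∀ p' ∈ S, p' ≠ p → expnt H σ p' = 0}
  one_mem' := fun p' hp' _ => expnt_one H hp'
  mul_mem' := fun {σ τ} hσ hτ p' hp' hne => by
    rw [expnt_mul H _ _ hp', hσ p' hp' hne, hτ p' hp' hne, add_zero]
  inv_mem' := fun {σ} hσ p' hp' hne => by rw [expnt_inv H _ hp', hσ p' hp' hne, neg_zero]

omit [IsGalois k L] [IsCyclotomicExtension {3} ℚ k] in
/-- Membership in `K_p`. [folklore] -/
theorem mem_kp {p : ℕ} {σ : L ≃ₐ[k] L} : σ ∈ kp H p ↔ ∀ p' ∈ S, p' ≠ p → expnt H σ p' = 0 :=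
  Iff.rfl

include H

/-- `M_p ∈ K_p`. [folklore] -/
theorem emm_mem_kp {p : ℕ} (hp : p ∈ S) : emm H hp ∈ kp H p := fun _ hp' hne => expnt_emm_ne H hp hp' hne

omit [IsGalois k L] [IsCyclotomicExtension {3} ℚ k] in
/-- `K_p` embeds into `ℤ/3` via `σ ↦ expnt σ p`; so `#K_p ≤ 3`. [folklore] -/
theorem card_kp_le {p : ℕ} (hp : p ∈ S) : Nat.card (kp H p) ≤ 3 := by
  have hinj : Function.Injective fun σ : kp H p => expnt H σ.1 p := by
    intro σ τ h
    apply Subtype.ext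
    exact eq_of_forall_expnt_eq H fun p' hp' => by
      by_cases hne : p' = p
      · subst hne; exact h
      · rw [σ.2 p' hp' hne, τ.2 p' hp' hne]
  have := Nat.card_le_card_of_injective _ hinj
  rwa [Nat.card_zmod] at this

omit [NumberField k] [NumberField L] [IsGalois k L] [IsCyclotomicExtension {3} ℚ k] in
/-- For `w ∋ p`, `p ∈ S`: `3 ∉ w` and `p' ∉ w` for the other `p' ∈ S`. [folklore] -/
theorem not_mem_of_mem (w : HeightOneSpectrum (𝓞 L)) {p : ℕ} (hp : p ∈ S) (hpw : (p : 𝓞 L) ∈ w.asIdeal) :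
    (3 : 𝓞 L) ∉ w.asIdeal ∧ ∀ p' ∈ S, p' ≠ p → (p' : 𝓞 L) ∉ w.asIdeal := by
  obtain ⟨hpP, hp3⟩ := H.prime_of_mem p hp
  refine ⟨?_, fun p' hp' hne => natCast_not_mem_of_natCast_mem w (H.prime_of_mem p' hp').1 hpP hne hpw⟩
  have := natCast_not_mem_of_natCast_mem w Nat.prime_three hpP (by omega) hpw
  exact_mod_cast this

omit [IsGalois k L] [IsCyclotomicExtension {3} ℚ k] in
/-- The inertia group of `w ∋ p` is contained in `K_p` (it fixes the cube roots of the `w`-units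
`p' ≠ p`). [cite: Lang1983, Ch. 6 Prop. 1.3] -/
theorem inertia_le_kp (w : HeightOneSpectrum (𝓞 L)) {p : ℕ} (hp : p ∈ S) (hpw : (p : 𝓞 L) ∈ w.asIdeal) :
    w.asIdeal.inertia (L ≃ₐ[k] L) ≤ kp H p := by
  intro σ hσ p' hp' hne
  haveI := w.isPrime
  obtain ⟨h3, hS⟩ := not_mem_of_mem H w hp hpw
  have hfix : σ • intRoot H hp' = intRoot H hp' :=
    smul_eq_self_of_mem_inertia_of_pow_eq w.asIdeal (d := 3) (by exact_mod_cast h3) (hS p' hp' hne)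
      (intRoot_pow_three H hp') hσ (by
        apply RingOfIntegers.ext
        change σ ((p' : 𝓞 L) : L) = ((p' : 𝓞 L) : L)
        simp)
  have h := congrArg (fun x : 𝓞 L => (x : L)) hfix
  simp only [coe_smul_intRoot, coe_intRoot] at h
  rw [expnt_eq_iff H σ hp', ZMod.val_zero, pow_zero, one_mul]
  exact h

omit [NumberField k] [NumberField L] [IsGalois k L] [IsCyclotomicExtension {3} ℚ k] in
/-- `μ_p ∈ w` for `w ∋ p`. [folklore] -/
theorem intRoot_mem (w : HeightOneSpectrum (𝓞 L)) {p : ℕ} (hp : p ∈ S) (hpw : (p : 𝓞 L) ∈ w.asIdeal) :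
    intRoot H hp ∈ w.asIdeal := by
  haveI := w.isPrime
  apply Ideal.IsPrime.mem_of_pow_mem (I := w.asIdeal) inferInstance 3
  rw [intRoot_pow_three H hp]; exact hpw

/-- **`e(w | (p)) = #I_w ≥ 3`, hence `I_w = K_p` has order `3`** for `w ∋ p`, `p ∈ S`: indeed
`v_w(p) = v_w(μ_p)³` is a cube while `v_w(p) = v_{(p)}(p)^e = e` (normalised), and `I_w ≤ K_p ↪ ℤ/3`.
[cite: Marcus2018, Ch. 4 Thm. 28] -/
theorem inertia_eq_kp (w : HeightOneSpectrum (𝓞 L)) {p : ℕ} (hp : p ∈ S) (hpw : (p : 𝓞 L) ∈ w.asIdeal) :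
    w.asIdeal.inertia (L ≃ₐ[k] L) = kp H p ∧ Nat.card (kp H p) = 3 ∧
      (w.under (𝓞 k)).asIdeal.ramificationIdx' w.asIdeal = 3 := by
  haveI : FiniteDimensional k L := finiteDimensional
  haveI : Module.Finite (𝓞 k) (𝓞 L) := IsIntegralClosure.finite (𝓞 k) k L (𝓞 L)
  haveI := isGaloisGroup (k := k) (L := L)
  haveI := w.isPrime
  haveI := (w.under (𝓞 k)).isPrime
  haveI : w.asIdeal.LiesOver (w.under (𝓞 k)).asIdeal := ⟨rfl⟩
  obtain ⟨hpP, hp3⟩ := H.prime_of_mem p hp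
  -- `#I = e`
  have hcardI : Nat.card (w.asIdeal.inertia (L ≃ₐ[k] L)) =
      (w.under (𝓞 k)).asIdeal.ramificationIdx' w.asIdeal := by
    rw [Ideal.ramificationIdx'_eq_ramificationIdx _ w.asIdeal (w.under (𝓞 k)).ne_bot,
      ← Ideal.ramificationIdxIn_eq_ramificationIdx (w.under (𝓞 k)).asIdeal w.asIdeal (L ≃ₐ[k] L),
      ← Ideal.card_inertia_eq_ramificationIdxIn (G := L ≃ₐ[k] L) (w.under (𝓞 k)).asIdeal w.asIdeal]
  -- `e ≥ 3` from valuations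
  have he3 : 3 ≤ (w.under (𝓞 k)).asIdeal.ramificationIdx' w.asIdeal := by
    set e := (w.under (𝓞 k)).asIdeal.ramificationIdx' w.asIdeal
    have hval := HeightOneSpectrum.valuation_liesOver L (w.under (𝓞 k)) w (p : k)
    rw [valuation_under_natCast_of_inert w hpP hp3 hpw] at hval
    have hcube : algebraMap k L (p : k) = (intRoot H hp : L) ^ 3 := by
      rw [map_natCast, coe_intRoot, H.pow_three p hp]
    rw [hcube, map_pow] at hval
    -- `v_w(μ_p) < 1`
    have hlt : w.valuation L (intRoot H hp : L) < 1 := by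
      rw [show ((intRoot H hp : 𝓞 L) : L) = algebraMap (𝓞 L) L (intRoot H hp) from rfl,
        HeightOneSpectrum.valuation_of_algebraMap, HeightOneSpectrum.intValuation_lt_one_iff_mem]
      exact intRoot_mem H w hp hpw
    have hne : w.valuation L (intRoot H hp : L) ≠ 0 :=
      (Valuation.ne_zero_iff _).mpr (root_ne_zero H hp)
    have hlog : log (w.valuation L (intRoot H hp : L)) < 0 := by
      rw [← log_one (M := ℤ)]; exact (log_lt_log hne one_ne_zero).mpr hlt
    have h := congrArg log hval
    simp only [log_pow, log_exp, nsmul_eq_mul] at h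
    push_cast at h
    omega
  have hle := inertia_le_kp H w hp hpw
  have hcard_le : Nat.card (w.asIdeal.inertia (L ≃ₐ[k] L)) ≤ Nat.card (kp H p) :=
    Subgroup.card_le_of_le hle
  have hkp := card_kp_le H hp
  have heq : Nat.card (w.asIdeal.inertia (L ≃ₐ[k] L)) = Nat.card (kp H p) := by omega
  refine ⟨Subgroup.eq_of_le_of_card_ge hle heq.ge, by omega, by omega⟩

/-- **The identity is a Frobenius at `w ∋ p` (`p ∈ S`)**: a Frobenius fixes the cube roots of the
other `p'` (`p'^{(p²−1)/3} ≡ 1 (mod p)`), so lies in `K_p = I_w`, and then `x^{p²} ≡ x (mod w)`.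
(Residue degree `1` over `k`: [VI] "prime divisor of absolute degree 1" after descending to `Ω`.)
[cite: Cassels1964ArithmeticVI, p. 68] -/
theorem isArithFrobAt_one_of_mem (w : HeightOneSpectrum (𝓞 L)) {p : ℕ} (hp : p ∈ S)
    (hpw : (p : 𝓞 L) ∈ w.asIdeal) : IsArithFrobAt (𝓞 k) (1 : L ≃ₐ[k] L) w.asIdeal := by
  haveI : FiniteDimensional k L := finiteDimensional
  haveI := isGaloisGroup (k := k) (L := L)
  haveI := w.isPrime
  haveI : Finite (𝓞 L ⧸ w.asIdeal) := Ideal.finiteQuotientOfFreeOfNeBot _ w.ne_bot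
  obtain ⟨hpP, hp3⟩ := H.prime_of_mem p hp
  obtain ⟨φ, hφ⟩ := IsArithFrobAt.exists_of_isInvariant (𝓞 k) (L ≃ₐ[k] L) w.asIdeal
  obtain ⟨h3, hS⟩ := not_mem_of_mem H w hp hpw
  have hN := card_quotient_under_of_inert (k := k) w hpP hp3 hpw
  -- `φ ∈ K_p`
  have hφK : φ ∈ kp H p := by
    intro p' hp' hne
    have hfix : φ • intRoot H hp' = intRoot H hp' := by
      refine SplitNorm.smul_eq_self_of_isArithFrobAt hφ (d := 3) (by exact_mod_cast h3)
        (a := (p' : 𝓞 k)) (by rw [map_natCast]; exact hS p' hp' hne)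
        (by rw [map_natCast]; exact intRoot_pow_three H hp') ?_ ?_
      · rw [HeightOneSpectrum.under_asIdeal] at hN
        rw [hN]
        exact ⟨(p - 1) * ((p + 1) / 3), by
          obtain ⟨j, hj⟩ : 3 ∣ p + 1 := by omega
          have hp1 : 1 ≤ p := hpP.one_lt.le
          rw [hj, Nat.mul_div_cancel_left _ (by norm_num : 0 < 3)]
          have hj' : ((p : ℤ) + 1) = 3 * (j : ℤ) := by exact_mod_cast hj
          zify [hp1, Nat.one_le_pow 2 p hp1]
          linear_combination ((p : ℤ) - 1) * hj'⟩
      · rw [HeightOneSpectrum.under_asIdeal] at hN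
        rw [hN, map_natCast]
        exact pow_sq_sub_one_div_three_sub_one_mem hpP hp3
          (fun h => hne ((Nat.prime_dvd_prime_iff_eq hpP (H.prime_of_mem p' hp').1).mp h).symm) w hpw
    have h := congrArg (fun x : 𝓞 L => (x : L)) hfix
    simp only [coe_smul_intRoot, coe_intRoot] at h
    rw [expnt_eq_iff H φ hp', ZMod.val_zero, pow_zero, one_mul]
    exact h
  -- so `φ` is in the inertia group and `1` is a Frobenius
  rw [← (inertia_eq_kp H w hp hpw).1] at hφK
  intro x
  have h1 := hφ x
  have h2 := hφK x
  simp only [MulSemiringAction.toAlgHom_apply, one_smul] at h1 ⊢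
  have := w.asIdeal.sub_mem h1 h2
  rwa [sub_sub_sub_cancel_left] at this

/-- **The decomposition group of `w ∋ p` is `K_p = I_w`**: `σ • w = w ↔ σ ∈ K_p`.
[cite: Marcus2018, Ch. 4 Thm. 28] -/
theorem smul_eq_self_iff_of_mem (w : HeightOneSpectrum (𝓞 L)) {p : ℕ} (hp : p ∈ S)
    (hpw : (p : 𝓞 L) ∈ w.asIdeal) (σ : L ≃ₐ[k] L) : σ • w = w ↔ σ ∈ kp H p := by
  constructor
  · intro h
    rw [← (inertia_eq_kp H w hp hpw).1]
    exact mem_inertia_of_smul_eq_of_isArithFrobAt_one (isArithFrobAt_one_of_mem H w hp hpw) h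
  · intro h
    rw [← (inertia_eq_kp H w hp hpw).1] at h
    haveI := w.isPrime
    have := Ideal.inertia_le_stabilizer (M := L ≃ₐ[k] L) w.asIdeal h
    rw [MulAction.mem_stabilizer_iff] at this
    exact HeightOneSpectrum.ext (by rw [HeightOneSpectrum.smul_asIdeal]; exact this)

/-- In particular `M_p • w = w` and `M_p • x ≡ x (mod w)` for `w ∋ p`. [folklore] -/
theorem emm_smul_eq (w : HeightOneSpectrum (𝓞 L)) {p : ℕ} (hp : p ∈ S) (hpw : (p : 𝓞 L) ∈ w.asIdeal) :
    emm H hp • w = w ∧ ∀ x : 𝓞 L, emm H hp • x - x ∈ w.asIdeal := by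
  refine ⟨(smul_eq_self_iff_of_mem H w hp hpw _).mpr (emm_mem_kp H hp), ?_⟩
  have h := emm_mem_kp H hp (p := p)
  rw [← (inertia_eq_kp H w hp hpw).1] at h
  exact h

/-- Residues at `w ∋ p` are represented by `𝓞 k`. [folklore] -/
theorem exists_sub_algebraMap_mem_of_mem (w : HeightOneSpectrum (𝓞 L)) {p : ℕ} (hp : p ∈ S)
    (hpw : (p : 𝓞 L) ∈ w.asIdeal) (x : 𝓞 L) :
    ∃ c : 𝓞 k, x - algebraMap (𝓞 k) (𝓞 L) c ∈ w.asIdeal :=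
  exists_sub_algebraMap_mem_of_isArithFrobAt_one (isArithFrobAt_one_of_mem H w hp hpw) x

/-- **`v_w(μ_p) = 1` normalised** (`exp (-1)`): `e = 3` and `v_w(p) = v_w(μ_p)³`. [folklore] -/
theorem valuation_root_of_mem (w : HeightOneSpectrum (𝓞 L)) {p : ℕ} (hp : p ∈ S)
    (hpw : (p : 𝓞 L) ∈ w.asIdeal) : w.valuation L (μ p) = exp (-1 : ℤ) := by
  obtain ⟨hpP, hp3⟩ := H.prime_of_mem p hp
  haveI : w.asIdeal.LiesOver (w.under (𝓞 k)).asIdeal := ⟨rfl⟩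
  have hval := HeightOneSpectrum.valuation_liesOver L (w.under (𝓞 k)) w (p : k)
  rw [valuation_under_natCast_of_inert w hpP hp3 hpw, (inertia_eq_kp H w hp hpw).2.2] at hval
  have hcube : algebraMap k L (p : k) = μ p ^ 3 := by rw [map_natCast, H.pow_three p hp]
  rw [hcube, map_pow] at hval
  have hne : w.valuation L (μ p) ≠ 0 := (Valuation.ne_zero_iff _).mpr (root_ne_zero H hp)
  have h := congrArg log hval
  simp only [log_pow, log_exp, nsmul_eq_mul] at h
  push_cast at h
  rw [← exp_log hne, show log (w.valuation L (μ p)) = -1 by omega]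

end AboveS

end MultiKummer

end Literature.NumberTheory.GaloisRepresentations
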